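import Summits.ResolutionOfSingularities.ResolutionOfSingularities.Theorems.PurelyInseparableDim4Perm2BoundTranslated
import Mathlib.Algebra.CharP.Lemmas
import HarnessLib

/-!
# [OURS · res-dim4-pi PR-2, part 5a] The translated PERM2-0 bound `d′ ≤ 2d − g + p^{e−1}` is attained,
  for every prime `p` and every exponent: one MODE-1h family (J-005 for all `p`, `e`) — the PARENT state

Cell `res-dim4-pi` (D-0157 DOOR 2), lineage **PR-2** (seat `res-dim4-p-2`, generation 2). Part 3
(`…Perm2BoundTranslated`, p648595) proved, for a clean state `(F, r, exc)` of the tree's coordinate-centre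
walk, a coordinate centre `V(z, x_S)` under Hauser–Perlega's condition (1) only, chart `j ∈ S` and a point
`b` over the origin of the centre, at `q = p^e`: `d′ + g ≤ 2d + p^{e−1}` (`d` the shade,
`g = ord_{(x_S)} F − Σ_S r_i`) — `Perm2Bound.shade_step_add_le_two_mul_add_pow`. Part 4 (`…Perm2BoundExcess`)
says what an excess over `2d − g` forces. THIS FILE and its sequel `…Perm2BoundSharpStep` (part 5b; split
for the 400-line rule: here §§1–3 = the data and the parent state over any field, there §§4–6 = the step
in characteristic `p` and the cell's words): the bound is SHARP, for every `p` and every exponent `e + 1`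
(`q = p^{e+1}`, `m = pᵉ`, `n = q − m = pᵉ(p − 1)`), by the explicit state

  `F = x₂ⁿ·x₄ᵐ·(x₂ − x₄ + x₁x₃)^q = x₂^{q+n}x₄ᵐ − x₂ⁿx₄^{q+m} + x₁^q x₂ⁿ x₃^q x₄ᵐ`, `r = (0, n, 0, m)`, `exc = {x₂, x₄}`

(`SharpFamily.parent`; indices `x₁…x₄ = 0…3`): `ord₀ F = 2q`, `d = q`; the plane `V(z, x₂, x₄)` is
Hironaka-permissible with `ord_{(x₂,x₄)} F = q = Σ_S r_i` EXACTLY (`g = 0 < d`: condition (2) FAILS, eclass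
C0) and no coordinate hyperplane is permissible (so the plane is a MODE-1h centre of record); at the point
`x₄ = 1` of the `x₂`-chart (`SharpFamily.pt`) the transform is `(x₄ + 1)^m (x₁x₃ − x₂x₄)^q =
(x₄^m + 1)(x₁^q x₃^q − x₂^q x₄^q)` (freshman's dream, twice), the cleaning deletes the two `q`-th powers,
`x₄` is lost and `x₂` is re-read with multiplicity `ord_S F − q = 0`: `F′ = x₄ᵐ(x₁^q x₃^q − x₂^q x₄^q)`,
`r′ = 0`, `exc′ = {x₂}`, `d′ = ord₀ F′ = 2q + m = 2d − g + p^{(e+1)−1}` — EQUALITY in part 3's bound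
(`translatedBound_attained`: part 3's hypotheses instantiated verbatim, its conclusion an equality), a
MODE-1h RISE:d `q ↦ 2q + pᵉ` (`exists_step1h_shade_eq`). At `e + 1 = 1` (the class of record, `q = p`,
`m = 1`) the rise is `p ↦ 2p + 1` (`exists_step1h_shade_eq_two_mul_add_one`); for `p = 2` the parent is
LITERALLY the census specimen J-005 «C0-T (+3)» of crit-3 BANK-A3-01 (`x₂x₄³ + x₂³x₄ + x₁²x₂x₃²x₄ ↦
x₂²x₄³ + x₁²x₃²x₄`, shade `2 ↦ 5`), certified by `decide` in `…ZooCertJ005` (p651175) — not restated; this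
is its all-`p`, all-`e` family, proved symbolically. MECHANISM (crit-3's reading of J-005, now for all
`p`, `e`): `G = w^q`, `w = ℓ + x₁x₃` with `ℓ = x₂ − x₄` in the ideal of the centre; at the fibre point
`ℓ ∘ π = x₂x₄ ∈ 𝔪²`, so `w ∘ π` has order `2`; the credit `|r| = q` evaporates (both components gone) and
the cleaning adds `pᵉ` through `(x₄ + 1)^{pᵉ} = x₄^{pᵉ} + 1` — the boundary case of Moh's bound at the
point step (compare `PointBlowup.mohBound_attained`: multiplicities `(pᵉ(p−1), pᵉ(p+1))`, same residues).

[OURS · counted 0 · AI work weaker than expert review] NOTHING here proves resolution of singularities in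
dimension ≥ 4 / characteristic `p`: an exact law of the letter `d` of OUR candidate frame (MODE 1h
coordinate game) — census value: crit-3's BANK LAW at translated points is optimal for every `p`, `e`.
bears_on: LADDER-RESOLUTION:D157-DOOR2 (res-dim4-pi · PR-2). Supports stmt-ResolutionOfSingularities-16155
(helper).
-/

noncomputable section

set_option linter.dupNamespace false -- mandated namespace of this single-conjunct summit
open MvPolynomial Finset
open scoped BigOperators

namespace Summit.ResolutionOfSingularities.ResolutionOfSingularities.Theorems.PIDim4
namespace Perm2Bound
open Literature.AlgebraicGeometry.Resolution
open Literature.AlgebraicGeometry.Resolution.CentreBlowup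
open Literature.AlgebraicGeometry.Resolution.Hauser2010

namespace SharpFamily

/-! ### §1 The data: exponents, parent state, point, child exponents -/

section Data
variable (q n m : ℕ)

/-- `E₁ = (0, q + n, 0, m)`, the exponent of `x₂^{q+n} x₄ᵐ`. [folklore] -/
def E₁ : Fin 4 →₀ ℕ := Finsupp.single 1 (q + n) + Finsupp.single 3 m
/-- `E₂ = (0, n, 0, q + m)`, the exponent of `x₂ⁿ x₄^{q+m}`. [folklore] -/
def E₂ : Fin 4 →₀ ℕ := Finsupp.single 1 n + Finsupp.single 3 (q + m)
/-- `E₃ = (q, n, q, m)`, the exponent of `x₁^q x₂ⁿ x₃^q x₄ᵐ`. [folklore] -/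
def E₃ : Fin 4 →₀ ℕ :=
  Finsupp.single 0 q + Finsupp.single 1 n + Finsupp.single 2 q + Finsupp.single 3 m
/-- `ρ = (0, n, 0, m)`, the exceptional multiplicities of the parent. [folklore] -/
def rvec : Fin 4 →₀ ℕ := Finsupp.single 1 n + Finsupp.single 3 m
/-- `A₃ = (q, 0, q, m)`, the exponent of the child's monomial `x₁^q x₃^q x₄ᵐ`. [folklore] -/
def A₃ : Fin 4 →₀ ℕ := Finsupp.single 0 q + Finsupp.single 2 q + Finsupp.single 3 m
/-- `A₂ = (0, q, 0, q + m)`, the exponent of the child's monomial `x₂^q x₄^{q+m}`. [folklore] -/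
def A₂ : Fin 4 →₀ ℕ := Finsupp.single 1 q + Finsupp.single 3 (q + m)
/-- `B₀ = (q, 0, q, 0)`: the `q`-th power `x₁^q x₃^q` the cleaning deletes. [folklore] -/
def B₀ : Fin 4 →₀ ℕ := Finsupp.single 0 q + Finsupp.single 2 q
/-- `B₁ = (0, q, 0, q)`: the `q`-th power `x₂^q x₄^q` the cleaning deletes. [folklore] -/
def B₁ : Fin 4 →₀ ℕ := Finsupp.single 1 q + Finsupp.single 3 q

/-- **The parent state** `(x₂^{q+n}x₄ᵐ − x₂ⁿx₄^{q+m} + x₁^q x₂ⁿ x₃^q x₄ᵐ, (0,n,0,m), {x₂,x₄})` of the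
family (`= x₂ⁿx₄ᵐ(x₂ − x₄ + x₁x₃)^q` in characteristic `p` when `q = p^{e+1}`, `parent_F_eq`). [folklore] -/
def parent (K : Type*) [Field K] : CState (Fin 4) K :=
  ⟨monomial (E₁ q n m) 1 - monomial (E₂ q n m) 1 + monomial (E₃ q n m) 1, rvec n m, {1, 3}⟩

/-- **The point** `x₄ = 1` of the `x₂`-chart (over the origin of the centre `V(z, x₂, x₄)`). [folklore] -/
def pt (K : Type*) [Field K] : Fin 4 → K := fun i => if i = 3 then 1 else 0

end Data

/-! ### §2 Bookkeeping of the exponents -/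

section Exponents
variable (q n m : ℕ)

/-- values of `E₁`. [folklore] -/
theorem E₁_apply : E₁ q n m 0 = 0 ∧ E₁ q n m 1 = q + n ∧ E₁ q n m 2 = 0 ∧ E₁ q n m 3 = m := by
  refine ⟨?_, ?_, ?_, ?_⟩ <;> simp [E₁]
/-- values of `E₂`. [folklore] -/
theorem E₂_apply : E₂ q n m 0 = 0 ∧ E₂ q n m 1 = n ∧ E₂ q n m 2 = 0 ∧ E₂ q n m 3 = q + m := by
  refine ⟨?_, ?_, ?_, ?_⟩ <;> simp [E₂]
/-- values of `E₃`. [folklore] -/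
theorem E₃_apply : E₃ q n m 0 = q ∧ E₃ q n m 1 = n ∧ E₃ q n m 2 = q ∧ E₃ q n m 3 = m := by
  refine ⟨?_, ?_, ?_, ?_⟩ <;> simp [E₃]
/-- values of `ρ`. [folklore] -/
theorem rvec_apply : rvec n m 0 = 0 ∧ rvec n m 1 = n ∧ rvec n m 2 = 0 ∧ rvec n m 3 = m := by
  refine ⟨?_, ?_, ?_, ?_⟩ <;> simp [rvec]
/-- values of `A₃`. [folklore] -/
theorem A₃_apply : A₃ q m 0 = q ∧ A₃ q m 1 = 0 ∧ A₃ q m 2 = q ∧ A₃ q m 3 = m := by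
  refine ⟨?_, ?_, ?_, ?_⟩ <;> simp [A₃]
/-- values of `A₂`. [folklore] -/
theorem A₂_apply : A₂ q m 0 = 0 ∧ A₂ q m 1 = q ∧ A₂ q m 2 = 0 ∧ A₂ q m 3 = q + m := by
  refine ⟨?_, ?_, ?_, ?_⟩ <;> simp [A₂]
/-- values of `B₀`. [folklore] -/
theorem B₀_apply : B₀ q 0 = q ∧ B₀ q 1 = 0 ∧ B₀ q 2 = q ∧ B₀ q 3 = 0 := by
  refine ⟨?_, ?_, ?_, ?_⟩ <;> simp [B₀]
/-- values of `B₁`. [folklore] -/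
theorem B₁_apply : B₁ q 0 = 0 ∧ B₁ q 1 = q ∧ B₁ q 2 = 0 ∧ B₁ q 3 = q := by
  refine ⟨?_, ?_, ?_, ?_⟩ <;> simp [B₁]

/-- degrees: `|E₁| = q + n + m`, `|E₂| = n + (q + m)`, `|E₃| = q + n + q + m`, `|ρ| = n + m`,
`|A₃| = q + q + m`, `|A₂| = q + (q + m)`, `|B₀| = |B₁| = q + q`. [folklore] -/
theorem degrees :
    (E₁ q n m).degree = q + n + m ∧ (E₂ q n m).degree = n + (q + m) ∧
    (E₃ q n m).degree = q + n + q + m ∧ (rvec n m).degree = n + m ∧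
    (A₃ q m).degree = q + q + m ∧ (A₂ q m).degree = q + (q + m) ∧
    (B₀ q).degree = q + q ∧ (B₁ q).degree = q + q := by
  simp only [E₁, E₂, E₃, rvec, A₃, A₂, B₀, B₁, map_add, Finsupp.degree_single, and_self]

/-- the parent exponents are `ρ` plus a `q`-th power exponent (so `x^ρ ∣ F`). [folklore] -/
theorem E_eq_rvec_add :
    E₁ q n m = rvec n m + Finsupp.single 1 q ∧ E₂ q n m = rvec n m + Finsupp.single 3 q ∧
    E₃ q n m = rvec n m + B₀ q := by
  refine ⟨?_, ?_, ?_⟩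
  · rw [E₁, rvec, Finsupp.single_add]; abel
  · rw [E₂, rvec, Finsupp.single_add]; abel
  · rw [E₃, rvec, B₀]; abel

variable {q m}

/-- distinctness of the exponents used (needs `0 < q`). [folklore] -/
theorem ne_facts (hq : 0 < q) :
    E₁ q n m ≠ E₂ q n m ∧ E₁ q n m ≠ E₃ q n m ∧ E₂ q n m ≠ E₃ q n m ∧ A₃ q m ≠ A₂ q m := by
  refine ⟨fun h => ?_, fun h => ?_, fun h => ?_, fun h => ?_⟩
  · have := DFunLike.congr_fun h 3
    rw [(E₁_apply q n m).2.2.2, (E₂_apply q n m).2.2.2] at this; omega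
  · have := DFunLike.congr_fun h 0
    rw [(E₁_apply q n m).1, (E₃_apply q n m).1] at this; omega
  · have := DFunLike.congr_fun h 0
    rw [(E₂_apply q n m).1, (E₃_apply q n m).1] at this; omega
  · have := DFunLike.congr_fun h 0
    rw [(A₃_apply q m).1, (A₂_apply q m).1] at this; omega

end Exponents

/-! ### §3 The parent state: coefficients, cleanness, order, shade, the centre -/

section Parent
variable {K : Type*} [Field K] (q n m : ℕ)

/-- the coefficients of the parent `F`. [folklore] -/
theorem coeff_parent_F (d : Fin 4 →₀ ℕ) :
    coeff d (parent q n m K).F = (if E₁ q n m = d then 1 else 0) - (if E₂ q n m = d then 1 else 0) +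
      (if E₃ q n m = d then 1 else 0) := by
  show coeff d (monomial (E₁ q n m) 1 - monomial (E₂ q n m) 1 + monomial (E₃ q n m) 1) = _
  rw [coeff_add, coeff_sub, coeff_monomial, coeff_monomial, coeff_monomial]

/-- the support of the parent `F` consists of (some of) `E₁, E₂, E₃`. [folklore] -/
theorem eq_of_mem_support_parent {d : Fin 4 →₀ ℕ} (hd : d ∈ (parent q n m K).F.support) :
    d = E₁ q n m ∨ d = E₂ q n m ∨ d = E₃ q n m := by
  rw [MvPolynomial.mem_support_iff, coeff_parent_F] at hd
  by_contra h
  push Not at h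
  rw [if_neg (Ne.symm h.1), if_neg (Ne.symm h.2.1), if_neg (Ne.symm h.2.2)] at hd
  exact hd (by ring)

variable {q m}

/-- `E₁` and `E₃` are in the support of the parent `F` (`0 < q`). [folklore] -/
theorem mem_support_parent (hq : 0 < q) :
    E₁ q n m ∈ (parent q n m K).F.support ∧ E₃ q n m ∈ (parent q n m K).F.support := by
  obtain ⟨h12, h13, h23, -⟩ := ne_facts n hq
  constructor
  · rw [MvPolynomial.mem_support_iff, coeff_parent_F, if_pos rfl, if_neg (Ne.symm h12),
      if_neg (Ne.symm h13)]
    norm_num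
  · rw [MvPolynomial.mem_support_iff, coeff_parent_F, if_neg h13, if_neg h23, if_pos rfl]
    norm_num

/-- **`x^ρ ∣ F`**: every exponent of the parent dominates `ρ`. [folklore] -/
theorem parent_r_le : ∀ d ∈ (parent q n m K).F.support, (parent q n m K).r ≤ d := by
  intro d hd
  show rvec n m ≤ d
  obtain ⟨h1, h2, h3⟩ := E_eq_rvec_add q n m
  rcases eq_of_mem_support_parent q n m hd with h | h | h <;> rw [h]
  · rw [h1]; exact le_self_add
  · rw [h2]; exact le_self_add
  · rw [h3]; exact le_self_add

/-- **the parent `F` is clean** (no `q`-th power monomials) when `0 < m < q` and `0 < n < q`. [folklore] -/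
theorem deletePthPowers_parent (hm0 : 0 < m) (hmq : m < q) (hn0 : 0 < n) (hnq : n < q) :
    deletePthPowers q (parent q n m K).F = (parent q n m K).F := by
  have hndm : ¬ q ∣ m := fun h => absurd (Nat.le_of_dvd hm0 h) (not_le.mpr hmq)
  have hndn : ¬ q ∣ n := fun h => absurd (Nat.le_of_dvd hn0 h) (not_le.mpr hnq)
  have h₁ : ¬ IsPthPowerExponent q (E₁ q n m) := fun h =>
    hndm ((E₁_apply q n m).2.2.2 ▸ (isPthPowerExponent_iff q _).mp h 3)
  have h₂ : ¬ IsPthPowerExponent q (E₂ q n m) := fun h =>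
    hndn ((E₂_apply q n m).2.1 ▸ (isPthPowerExponent_iff q _).mp h 1)
  have h₃ : ¬ IsPthPowerExponent q (E₃ q n m) := fun h =>
    hndm ((E₃_apply q n m).2.2.2 ▸ (isPthPowerExponent_iff q _).mp h 3)
  show deletePthPowers q (monomial (E₁ q n m) 1 - monomial (E₂ q n m) 1 + monomial (E₃ q n m) 1) =
    monomial (E₁ q n m) 1 - monomial (E₂ q n m) 1 + monomial (E₃ q n m) 1
  have hsub : (monomial (E₁ q n m) (1 : K) - monomial (E₂ q n m) 1) =
      monomial (E₁ q n m) 1 + monomial (E₂ q n m) (-1) := by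
    rw [sub_eq_add_neg, ← map_neg]
  rw [hsub, deletePthPowers_add, deletePthPowers_add, deletePthPowers_monomial,
    deletePthPowers_monomial, deletePthPowers_monomial, if_neg h₁, if_neg h₂, if_neg h₃]

/-- **`ord₀ F = 2q`** for the parent (`n + m = q`, `0 < q`). [folklore] -/
theorem ordZero_parent (hn : n + m = q) (hq : 0 < q) :
    ordZero (parent q n m K).F = ((2 * q : ℕ) : ℕ∞) := by
  obtain ⟨hd1, hd2, hd3, -⟩ := degrees q n m
  rw [ordZero_eq_nat_iff]
  refine ⟨⟨E₁ q n m, MvPolynomial.mem_support_iff.mp (mem_support_parent n hq).1, by rw [hd1]; omega⟩,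
    fun d hd => ?_⟩
  rw [coeff_parent_F]
  have h1 : ¬ E₁ q n m = d := fun h => by rw [← h, hd1] at hd; omega
  have h2 : ¬ E₂ q n m = d := fun h => by rw [← h, hd2] at hd; omega
  have h3 : ¬ E₃ q n m = d := fun h => by rw [← h, hd3] at hd; omega
  rw [if_neg h1, if_neg h2, if_neg h3]; ring

/-- **shade `d = q`** for the parent. [folklore] -/
theorem shade_parent (hn : n + m = q) (hq : 0 < q) : (parent q n m K).shade = (q : ℕ∞) := by
  show ordZero (parent q n m K).F - ((rvec n m).degree : ℕ∞) = _
  rw [ordZero_parent n hn hq, (degrees q n m).2.2.2.1, ← ENat.coe_sub]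
  norm_cast; omega

/-- `degIn {x₂,x₄} d = d₁ + d₃`. [folklore] -/
theorem degIn_S (d : Fin 4 →₀ ℕ) : degIn ({1, 3} : Finset (Fin 4)) d = d 1 + d 3 :=
  degIn_pair (by decide) d

/-- **condition (1) along `V(z, x₂, x₄)`**: every monomial of the parent has `S`-degree `≥ q`. [folklore] -/
theorem le_degIn_parent (hn : n + m = q) :
    ∀ d ∈ (parent q n m K).F.support, q ≤ degIn ({1, 3} : Finset (Fin 4)) d := by
  intro d hd
  rw [degIn_S]
  rcases eq_of_mem_support_parent q n m hd with h | h | h <;> rw [h]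
  · rw [(E₁_apply q n m).2.1, (E₁_apply q n m).2.2.2]; omega
  · rw [(E₂_apply q n m).2.1, (E₂_apply q n m).2.2.2]; omega
  · rw [(E₃_apply q n m).2.1, (E₃_apply q n m).2.2.2]; omega

/-- **`ord_{(x₂,x₄)} F = q` exactly** (attained at `x₁^q x₂ⁿ x₃^q x₄ᵐ`). [folklore] -/
theorem ordAlong_parent (hn : n + m = q) (hq : 0 < q) :
    ordAlong ({1, 3} : Finset (Fin 4)) (parent q n m K).F = (q : ℕ∞) := by
  apply le_antisymm
  · have h := ordAlong_le_of_mem_support (S := ({1, 3} : Finset (Fin 4)))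
      (mem_support_parent n hq (K := K) (m := m)).2
    rw [degIn_S, (E₃_apply q n m).2.1, (E₃_apply q n m).2.2.2, hn] at h
    exact h
  · exact le_ordAlong_of_forall (le_degIn_parent n hn)

/-- `Σ_S r_i = q` for the parent. [folklore] -/
theorem degIn_parent_r (hn : n + m = q) : degIn ({1, 3} : Finset (Fin 4)) (parent q n m K).r = q := by
  show degIn ({1, 3} : Finset (Fin 4)) (rvec n m) = q
  rw [degIn_S, (rvec_apply n m).2.1, (rvec_apply n m).2.2.2, hn]

/-- **condition (2) FAILS** for the parent and the plane centre: `Σ_S r_i + d = 2q > q = ord_S F`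
(perm2 = 0, eclass C0). [folklore] -/
theorem not_perm2_parent (hn : n + m = q) (hq : 0 < q) :
    ¬ ((degIn ({1, 3} : Finset (Fin 4)) (parent q n m K).r : ℕ∞) + (parent q n m K).shade ≤
        ordAlong ({1, 3} : Finset (Fin 4)) (parent q n m K).F) := by
  rw [degIn_parent_r n hn, shade_parent n hn hq, ordAlong_parent n hn hq]
  intro h
  have h' : q + q ≤ q := by exact_mod_cast h
  omega

/-- **no coordinate hyperplane is a permissible centre** for the parent: `ord_{(x_i)} F < q` for every
`i` (so the plane `V(z, x₂, x₄)` has the least cardinality among permissible coordinate centres). [folklore] -/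
theorem ordAlong_singleton_parent_lt (hn : n + m = q) (hm0 : 0 < m) (hn0 : 0 < n) (i : Fin 4) :
    ordAlong ({i} : Finset (Fin 4)) (parent q n m K).F < (q : ℕ∞) := by
  have hq : 0 < q := by omega
  obtain ⟨hE₁s, hE₃s⟩ := mem_support_parent n hq (K := K) (m := m)
  -- a monomial of `F` whose `x_i`-exponent is `< q`: `E₃` for `i = x₂`, `E₁` otherwise
  obtain ⟨d, hd, hdi⟩ : ∃ d ∈ (parent q n m K).F.support, d i < q := by
    by_cases hi : i = 1
    · exact ⟨E₃ q n m, hE₃s, by rw [hi, (E₃_apply q n m).2.1]; omega⟩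
    · refine ⟨E₁ q n m, hE₁s, ?_⟩
      have h : E₁ q n m i ≤ m := by
        unfold E₁
        rw [Finsupp.add_apply, Finsupp.single_apply, Finsupp.single_apply, if_neg (Ne.symm hi)]
        split_ifs <;> omega
      exact lt_of_le_of_lt h (by omega)
  have h := ordAlong_le_of_mem_support (S := ({i} : Finset (Fin 4))) hd
  rw [degIn_singleton] at h
  exact lt_of_le_of_lt h (by exact_mod_cast hdi)

end Parent

end SharpFamily

end Perm2Bound

end Summit.ResolutionOfSingularities.ResolutionOfSingularities.Theorems.PIDim4

end
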